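import Summits.ResolutionOfSingularities.ResolutionOfSingularities.Theorems.FrobeniusLadderFInjectiveMacaulayficationWildCoverFedder
import Summits.ResolutionOfSingularities.ResolutionOfSingularities.Theorems.FrobeniusLadderFInjectiveMacaulayficationPencilPhiPrime
import Summits.ResolutionOfSingularities.ResolutionOfSingularities.Theorems.FrobeniusLadderFInjectiveMacaulayficationPencilIntegral
import HarnessLib

/-!
# «(†) = FEDDER ON DEEP SUPPORT»: over a point `Q` of the base where the monomial generator `M` of a pencil `(M, B)` lies in the Frobenius power `𝔪_Q^{[p]}` (all its multiplicities through `Q`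
# are `≥ p`), the F-purity of the pencil blow-up `{M·W = B} ∪ {B·U = M}` at EVERY point of the fibre `ℙ¹_Q` is Fedderʼs test for the ONE hypersurface `V(B)` at `Q`: `B^{p−1} ∉ 𝔪_Q^{[p]}`
# (crux `FInjectiveMacaulayfication` stmt-ResolutionOfSingularities-15315, chain w45a; res-L1-w45a-plan-1 RULING R24.7 (b) TIER line «on Supp M with all multiplicities ≥ p the (†) criterion IS
# F-purity of h̃ (res-L1-w45a-tri-2ʼs 2-line Fedder reduction) … LEMMA-CANDIDATE «(†) = Fedder on deep support» noted for the registrar (stub-1, optional S)»; seat res-L1-w45a-stub-1 g16)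

[OURS · L1 W4.5a] Support file (`--supports stmt-ResolutionOfSingularities-15315 --as helper`); theorems only; GENERIC (any field `k` of characteristic `p`, any number of base variables, any
`M`, `B`); no named fact; NOT a statement of any manuscript; nothing of the crux is proved; no census row is asserted. AI-written (AI review is weaker than expert review).

WHAT IS PROVED AND FROM WHAT. Letters as in ✓ `WildCoverFedder` / ✓ `PencilExitTagMaster`: base `k[y₁..yₙ]` (`Fin n`), pencil variable `W` (resp. `U`) `= X 0` of `k[X 0..X n]`, `q⁺ = rename Fin.succ q`,
a `k`-point `(w₀; β)` with Frobenius-power ideal `J_{(w₀;β)} = ((X 0 − w₀)^p, (X i⁺ − βᵢ)^p)` upstairs and `I_β = ((yᵢ − βᵢ)^p)` downstairs. The `W`-chart equation is `Φ_W = M⁺·X 0 − B⁺`, the `U`-chart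
equation `Φ_U = B⁺·X 0 − M⁺`. DEEP SUPPORT means `M ∈ I_β`.
* §1 (pure algebra, every `w₀`): `pencilW_pow_mem_iff_of_deep` — `Φ_W^{p−1} ∈ J_{(w₀;β)} ↔ B^{p−1} ∈ I_β` (two lines: `M⁺·X 0 ∈ J`, so ✓ `WildCoverFedder.sub_pow_mem_iff` + ✓ `rename_pow_mem_span_pow_iff`);
  `pencilU_pow_mem_iff_of_deep` — at the pole `u₀ = 0`: `Φ_U^{p−1} ∈ J_{(0;β)} ↔ B^{p−1} ∈ I_β` (the `X 0^{p−1}`-coefficient, `mem_of_X_pow_mul_rename_mem`). So Fedderʼs membership is CONSTANT along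
  the fibre and equals that of `V(B)` at `β` — res-L1-w45a-tri-2ʼs (†) of `Q17-OMEGA-BREAKTEST-tri2.md` §B in the deep-support case, its corollary (a).
* §2 (stalk clauses, through ✓ `FedderAtMaximalIdeal.fedder_criterion_maximalIdeal`): ★ `clause_pencilW_iff_of_deep`, ★ `clause_pencilU_pole_iff_of_deep` — `CMCl ∧ FCl p` of
  `k[X 0..X n]_P/(Φ)` at `P = (w₀; β)` resp. `(0; β)` iff `B^{p−1} ∉ I_β`; `fullCl_pencilW_iff_of_deep` / `fullCl_pencilU_pole_iff_of_deep` (the `IsDomain` clause supplied by the caller, e.g. from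
  ✓ `PencilIntegral.pencilChart_isPrime`).
* §3 `monomial_mem_span_sub_C_pow` — a monomial `y^{M₁}` with `M₁ i ≥ p` at some coordinate with `βᵢ = 0` lies in `I_β` (the deep-support hypothesis for monomial `M`).
NOT a corollary of ✓p692285 `PencilFedderFull` / ✓p701797 `PencilExitTagMaster` (those need a Fedder CERTIFICATE resp. the tag data); it is the iff that makes such certificates unnecessary on deep support.
[cite: Fedder1983, Prop. 1.7 and Thm. 1.12]
-/

set_option linter.dupNamespace false

noncomputable section

open MvPolynomial IsLocalRing

namespace Summit.ResolutionOfSingularities.ResolutionOfSingularities.Theorems.FInjectiveMacaulayfication.PencilDeepSupportFedder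

open Summit.ResolutionOfSingularities.ResolutionOfSingularities.Theorems.FInjectiveMacaulayfication
open WildCoverFedder SliceableCentre

/-! ## §1 Fedder membership of the two chart equations on deep support -/

section Algebra

variable (k : Type) [Field k] (n : ℕ) {p : ℕ}

/-- `M ∈ I_β ⇒ M⁺ ∈ J_{(w₀;β)}`. [plumbing over ✓ `WildCoverFedder.map_rename_span_pow_le`] -/
theorem rename_mem_span_pow_of_mem (w₀ : k) (β : Fin n → k) {M : MvPolynomial (Fin n) k}
    (hM : M ∈ Ideal.span (Set.range fun i : Fin n => (X i - C (β i) : MvPolynomial (Fin n) k) ^ p)) :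
    (rename Fin.succ M : MvPolynomial (Fin (n + 1)) k) ∈ Ideal.span (Set.range fun j : Fin (n + 1) => (X j - C (Fin.cons w₀ β j) : MvPolynomial (Fin (n + 1)) k) ^ p) :=
  map_rename_span_pow_le k n p w₀ β (Ideal.mem_map_of_mem _ hM)

/-- ★ **`W`-CHART ON DEEP SUPPORT**: if `M ∈ I_β = ((yᵢ − βᵢ)^p)` then for every `w₀` and every exponent `m`, `(M⁺·X 0 − B⁺)^m ∈ J_{(w₀;β)} ↔ B^m ∈ I_β` — the term `M⁺·X 0` already lies in `J`.
[OURS · (†) on deep support, `W`-chart; folklore] -/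
theorem pencilW_pow_mem_iff_of_deep (hp : p ≠ 0) (w₀ : k) (β : Fin n → k) (M B : MvPolynomial (Fin n) k)
    (hM : M ∈ Ideal.span (Set.range fun i : Fin n => (X i - C (β i) : MvPolynomial (Fin n) k) ^ p)) (m : ℕ) :
    (rename Fin.succ M * X 0 - rename Fin.succ B : MvPolynomial (Fin (n + 1)) k) ^ m ∈
        Ideal.span (Set.range fun j : Fin (n + 1) => (X j - C (Fin.cons w₀ β j) : MvPolynomial (Fin (n + 1)) k) ^ p) ↔
      B ^ m ∈ Ideal.span (Set.range fun i : Fin n => (X i - C (β i) : MvPolynomial (Fin n) k) ^ p) := by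
  rw [sub_pow_mem_iff _ (Ideal.mul_mem_right _ _ (rename_mem_span_pow_of_mem k n w₀ β hM))]
  exact rename_pow_mem_span_pow_iff k n hp w₀ β B m

/-- **The `X 0^j`-coefficient, `j < p`**: `X 0^j · H⁺ ∈ J_{(0;β)} = (X 0^p, (X i⁺ − βᵢ)^p) ⇒ H ∈ I_β` (through `k[X 0..X n] ≅ k[y][X]`, Mathlib `Polynomial.mem_map_C_iff`). [folklore] -/
theorem mem_of_X_pow_mul_rename_mem (β : Fin n → k) (H : MvPolynomial (Fin n) k) {j : ℕ} (hj : j < p)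
    (h : (X 0 : MvPolynomial (Fin (n + 1)) k) ^ j * rename Fin.succ H ∈
      Ideal.span (Set.range fun i : Fin (n + 1) => (X i - C (Fin.cons 0 β i) : MvPolynomial (Fin (n + 1)) k) ^ p)) :
    H ∈ Ideal.span (Set.range fun i : Fin n => (X i - C (β i) : MvPolynomial (Fin n) k) ^ p) := by
  set I : Ideal (MvPolynomial (Fin n) k) := Ideal.span (Set.range fun i : Fin n => (X i - C (β i) : MvPolynomial (Fin n) k) ^ p) with hI
  set e : MvPolynomial (Fin (n + 1)) k →+* Polynomial (MvPolynomial (Fin n) k) :=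
    (MvPolynomial.finSuccEquiv k n : MvPolynomial (Fin (n + 1)) k →+* Polynomial (MvPolynomial (Fin n) k)) with he
  -- the image ideal sits inside `(X^p) ⊔ I·k[y][X]`
  have hle : (Ideal.span (Set.range fun i : Fin (n + 1) => (X i - C (Fin.cons 0 β i) : MvPolynomial (Fin (n + 1)) k) ^ p)).map e ≤
      Ideal.span {(Polynomial.X : Polynomial (MvPolynomial (Fin n) k)) ^ p} ⊔ I.map Polynomial.C := by
    rw [Ideal.map_span, Ideal.span_le]
    rintro _ ⟨_, ⟨i, rfl⟩, rfl⟩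
    refine Fin.cases ?_ (fun i => ?_) i
    · have h0 : e ((X 0 - C ((Fin.cons 0 β : Fin (n + 1) → k) 0)) ^ p) = Polynomial.X ^ p := by
        rw [Fin.cons_zero, C_0, sub_zero, map_pow, he, RingHom.coe_coe, MvPolynomial.finSuccEquiv_X_zero]
      rw [h0]
      exact Ideal.mem_sup_left (Ideal.mem_span_singleton_self _)
    · have h1 : e ((X i.succ - C ((Fin.cons 0 β : Fin (n + 1) → k) i.succ)) ^ p) = Polynomial.C ((X i - C (β i)) ^ p) := by
        rw [Fin.cons_succ, he, RingHom.coe_coe, ← rename_X (Fin.succ : Fin n → Fin (n + 1)) i, ← rename_C (Fin.succ : Fin n → Fin (n + 1)) (β i), ← map_sub, ← map_pow,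
          PencilIntegral.finSuccEquiv_rename_succ]
      rw [h1]
      exact Ideal.mem_sup_right (Ideal.mem_map_of_mem _ (Ideal.subset_span ⟨i, rfl⟩))
  have hmem : (Polynomial.X : Polynomial (MvPolynomial (Fin n) k)) ^ j * Polynomial.C H ∈
      Ideal.span {(Polynomial.X : Polynomial (MvPolynomial (Fin n) k)) ^ p} ⊔ I.map Polynomial.C := by
    have := hle (Ideal.mem_map_of_mem e h)
    rwa [map_mul, map_pow, he, RingHom.coe_coe, MvPolynomial.finSuccEquiv_X_zero, PencilIntegral.finSuccEquiv_rename_succ] at this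
  obtain ⟨a, ha, g, hg, hsum⟩ := Submodule.mem_sup.mp hmem
  obtain ⟨c, rfl⟩ := Ideal.mem_span_singleton'.mp ha
  -- compare the `X^j`-coefficients: `H = coeff_j (c·X^p) + coeff_j g = coeff_j g ∈ I`
  have hcoef := congrArg (fun q : Polynomial (MvPolynomial (Fin n) k) => q.coeff j) hsum
  simp only [Polynomial.coeff_add, Polynomial.coeff_X_pow_mul', Polynomial.coeff_C, if_true, le_refl, Polynomial.coeff_mul_X_pow', not_le.mpr hj, if_false, zero_add,
    tsub_self] at hcoef
  rw [← hcoef]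
  exact (Ideal.mem_map_C_iff.mp hg) j

/-- ★ **`U`-CHART POLE ON DEEP SUPPORT**: if `M ∈ I_β` then `(B⁺·X 0 − M⁺)^{p−1} ∈ J_{(0;β)} ↔ B^{p−1} ∈ I_β` (`M⁺ ∈ J`, and `X 0^{p−1}·(B^{p−1})⁺ ∈ J` iff its `X 0^{p−1}`-coefficient
`B^{p−1}` lies in `I_β`). [OURS · (†) on deep support, `U`-pole; folklore] -/
theorem pencilU_pow_mem_iff_of_deep (hp : p ≠ 0) (β : Fin n → k) (M B : MvPolynomial (Fin n) k)
    (hM : M ∈ Ideal.span (Set.range fun i : Fin n => (X i - C (β i) : MvPolynomial (Fin n) k) ^ p)) :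
    (rename Fin.succ B * X 0 - rename Fin.succ M : MvPolynomial (Fin (n + 1)) k) ^ (p - 1) ∈
        Ideal.span (Set.range fun j : Fin (n + 1) => (X j - C (Fin.cons 0 β j) : MvPolynomial (Fin (n + 1)) k) ^ p) ↔
      B ^ (p - 1) ∈ Ideal.span (Set.range fun i : Fin n => (X i - C (β i) : MvPolynomial (Fin n) k) ^ p) := by
  set J : Ideal (MvPolynomial (Fin (n + 1)) k) := Ideal.span (Set.range fun j : Fin (n + 1) => (X j - C (Fin.cons 0 β j) : MvPolynomial (Fin (n + 1)) k) ^ p) with hJ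
  have hneg : (rename Fin.succ B * X 0 - rename Fin.succ M : MvPolynomial (Fin (n + 1)) k) ^ (p - 1) =
      (-1) ^ (p - 1) * (rename Fin.succ M - rename Fin.succ B * X 0) ^ (p - 1) := by
    rw [← neg_sub, neg_pow]
  rw [hneg, Ideal.unit_mul_mem_iff_mem _ ((isUnit_one.neg).pow _), sub_pow_mem_iff _ (rename_mem_span_pow_of_mem k n 0 β hM)]
  have hrw : (rename Fin.succ B * X 0 : MvPolynomial (Fin (n + 1)) k) ^ (p - 1) = X 0 ^ (p - 1) * rename Fin.succ (B ^ (p - 1)) := by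
    rw [mul_pow, map_pow, mul_comm]
  rw [hrw]
  constructor
  · exact fun h => mem_of_X_pow_mul_rename_mem k n β _ (Nat.sub_lt (Nat.pos_of_ne_zero hp) Nat.one_pos) h
  · intro h
    have h' := (rename_pow_mem_span_pow_iff k n hp 0 β B (p - 1)).mpr h
    rw [← map_pow] at h'
    exact Ideal.mul_mem_left _ _ h'

end Algebra

/-! ## §2 The stalk clauses along the fibre -/

section Fedder

variable (k : Type) [Field k] (n : ℕ) (p : ℕ) [Fact p.Prime] [CharP k p]

omit [CharP k p] in
/-- The `U`-chart equation `B⁺·X 0 − M⁺` is nonzero when `M ≠ 0` (set `X 0 = 0`). [plumbing] -/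
theorem pencilPhiU_ne_zero (M B : MvPolynomial (Fin n) k) (hM : M ≠ 0) : (rename Fin.succ B * X 0 - rename Fin.succ M : MvPolynomial (Fin (n + 1)) k) ≠ 0 := by
  intro h
  have h' := congrArg ((aeval (Fin.cons (C (0 : k)) X : Fin (n + 1) → MvPolynomial (Fin n) k)).toRingHom) h
  rw [map_sub, map_mul, evalZ_rename, evalZ_X_zero, evalZ_rename, map_zero, map_zero, mul_zero, zero_sub, neg_eq_zero] at h'
  exact hM h'

/-- ★★ **THE `W`-CHART CLAUSE ON DEEP SUPPORT**: at the `k`-point `P = (w₀; β)` of `Φ_W = M⁺·X 0 − B⁺` (`Φ_W ∈ P`, `M ≠ 0`, `M ∈ I_β`), `CMCl ∧ FCl p` of `k[X 0..X n]_P/(Φ_W)` holds iff `V(B)` passes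
Fedderʼs test at `β`: `B^{p−1} ∉ ((yᵢ − βᵢ)^p)` — the same condition for EVERY `w₀`. [OURS · (†) on deep support; cite: Fedder1983, Prop. 1.7 and Thm. 1.12] -/
theorem clause_pencilW_iff_of_deep (w₀ : k) (β : Fin n → k) (M B : MvPolynomial (Fin n) k) (hM0 : M ≠ 0)
    (hM : M ∈ Ideal.span (Set.range fun i : Fin n => (X i - C (β i) : MvPolynomial (Fin n) k) ^ p))
    (P : Ideal (MvPolynomial (Fin (n + 1)) k)) [P.IsMaximal]
    (hP : P = Ideal.span (Set.range fun j : Fin (n + 1) => (X j - C (Fin.cons w₀ β j) : MvPolynomial (Fin (n + 1)) k)))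
    (hΦP : (rename Fin.succ M * X 0 - rename Fin.succ B : MvPolynomial (Fin (n + 1)) k) ∈ P) :
    (CMCl (Localization.AtPrime P ⧸ Ideal.span {algebraMap (MvPolynomial (Fin (n + 1)) k) (Localization.AtPrime P) (rename Fin.succ M * X 0 - rename Fin.succ B)}) ∧
      FCl p (Localization.AtPrime P ⧸ Ideal.span {algebraMap (MvPolynomial (Fin (n + 1)) k) (Localization.AtPrime P) (rename Fin.succ M * X 0 - rename Fin.succ B)})) ↔
      B ^ (p - 1) ∉ Ideal.span (Set.range fun i : Fin n => (X i - C (β i) : MvPolynomial (Fin n) k) ^ p) := by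
  rw [SeparableBaseChangeAscent.cmCl_and_fCl_iff,
    FedderAtMaximalIdeal.fedder_criterion_maximalIdeal k (n + 1) (n + 1) p P _ hP _ hΦP (PencilPhiPrime.pencilPhi_ne_zero k M B hM0),
    pencilW_pow_mem_iff_of_deep k n (Fact.out : p.Prime).ne_zero w₀ β M B hM]

/-- ★★ **THE `U`-POLE CLAUSE ON DEEP SUPPORT**: at `P = (0; β)` of `Φ_U = B⁺·X 0 − M⁺` (the point `W = ∞` of the fibre), `CMCl ∧ FCl p` of `k[X 0..X n]_P/(Φ_U)` holds iff `B^{p−1} ∉ ((yᵢ − βᵢ)^p)`.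
[OURS · (†) on deep support; cite: Fedder1983, Prop. 1.7 and Thm. 1.12] -/
theorem clause_pencilU_pole_iff_of_deep (β : Fin n → k) (M B : MvPolynomial (Fin n) k) (hM0 : M ≠ 0)
    (hM : M ∈ Ideal.span (Set.range fun i : Fin n => (X i - C (β i) : MvPolynomial (Fin n) k) ^ p))
    (P : Ideal (MvPolynomial (Fin (n + 1)) k)) [P.IsMaximal]
    (hP : P = Ideal.span (Set.range fun j : Fin (n + 1) => (X j - C (Fin.cons 0 β j) : MvPolynomial (Fin (n + 1)) k)))
    (hΦP : (rename Fin.succ B * X 0 - rename Fin.succ M : MvPolynomial (Fin (n + 1)) k) ∈ P) :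
    (CMCl (Localization.AtPrime P ⧸ Ideal.span {algebraMap (MvPolynomial (Fin (n + 1)) k) (Localization.AtPrime P) (rename Fin.succ B * X 0 - rename Fin.succ M)}) ∧
      FCl p (Localization.AtPrime P ⧸ Ideal.span {algebraMap (MvPolynomial (Fin (n + 1)) k) (Localization.AtPrime P) (rename Fin.succ B * X 0 - rename Fin.succ M)})) ↔
      B ^ (p - 1) ∉ Ideal.span (Set.range fun i : Fin n => (X i - C (β i) : MvPolynomial (Fin n) k) ^ p) := by
  rw [SeparableBaseChangeAscent.cmCl_and_fCl_iff,
    FedderAtMaximalIdeal.fedder_criterion_maximalIdeal k (n + 1) (n + 1) p P _ hP _ hΦP (pencilPhiU_ne_zero k n M B hM0),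
    pencilU_pow_mem_iff_of_deep k n (Fact.out : p.Prime).ne_zero β M B hM]

/-- ★ **`FullCl` FORM, `W`-chart** (the domain clause supplied by the caller, e.g. from ✓ `PencilIntegral.pencilChart_isPrime` / ✓ `affinePencilChart_isPrime`). [OURS · (†) on deep support] -/
theorem fullCl_pencilW_iff_of_deep (w₀ : k) (β : Fin n → k) (M B : MvPolynomial (Fin n) k) (hM0 : M ≠ 0)
    (hM : M ∈ Ideal.span (Set.range fun i : Fin n => (X i - C (β i) : MvPolynomial (Fin n) k) ^ p))
    (P : Ideal (MvPolynomial (Fin (n + 1)) k)) [P.IsMaximal]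
    (hP : P = Ideal.span (Set.range fun j : Fin (n + 1) => (X j - C (Fin.cons w₀ β j) : MvPolynomial (Fin (n + 1)) k)))
    (hΦP : (rename Fin.succ M * X 0 - rename Fin.succ B : MvPolynomial (Fin (n + 1)) k) ∈ P)
    (hdom : IsDomain (Localization.AtPrime P ⧸ Ideal.span {algebraMap (MvPolynomial (Fin (n + 1)) k) (Localization.AtPrime P) (rename Fin.succ M * X 0 - rename Fin.succ B)})) :
    FullCl p (Localization.AtPrime P ⧸ Ideal.span {algebraMap (MvPolynomial (Fin (n + 1)) k) (Localization.AtPrime P) (rename Fin.succ M * X 0 - rename Fin.succ B)}) ↔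
      B ^ (p - 1) ∉ Ideal.span (Set.range fun i : Fin n => (X i - C (β i) : MvPolynomial (Fin n) k) ^ p) := by
  rw [← clause_pencilW_iff_of_deep k n p w₀ β M B hM0 hM P hP hΦP, SeparableBaseChangeAscent.cmCl_and_fCl_iff]
  exact ⟨fun h => h.2, fun h => ⟨hdom, h⟩⟩

/-- ★ **`FullCl` FORM, `U`-pole**. [OURS · (†) on deep support] -/
theorem fullCl_pencilU_pole_iff_of_deep (β : Fin n → k) (M B : MvPolynomial (Fin n) k) (hM0 : M ≠ 0)
    (hM : M ∈ Ideal.span (Set.range fun i : Fin n => (X i - C (β i) : MvPolynomial (Fin n) k) ^ p))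
    (P : Ideal (MvPolynomial (Fin (n + 1)) k)) [P.IsMaximal]
    (hP : P = Ideal.span (Set.range fun j : Fin (n + 1) => (X j - C (Fin.cons 0 β j) : MvPolynomial (Fin (n + 1)) k)))
    (hΦP : (rename Fin.succ B * X 0 - rename Fin.succ M : MvPolynomial (Fin (n + 1)) k) ∈ P)
    (hdom : IsDomain (Localization.AtPrime P ⧸ Ideal.span {algebraMap (MvPolynomial (Fin (n + 1)) k) (Localization.AtPrime P) (rename Fin.succ B * X 0 - rename Fin.succ M)})) :
    FullCl p (Localization.AtPrime P ⧸ Ideal.span {algebraMap (MvPolynomial (Fin (n + 1)) k) (Localization.AtPrime P) (rename Fin.succ B * X 0 - rename Fin.succ M)}) ↔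
      B ^ (p - 1) ∉ Ideal.span (Set.range fun i : Fin n => (X i - C (β i) : MvPolynomial (Fin n) k) ^ p) := by
  rw [← clause_pencilU_pole_iff_of_deep k n p β M B hM0 hM P hP hΦP, SeparableBaseChangeAscent.cmCl_and_fCl_iff]
  exact ⟨fun h => h.2, fun h => ⟨hdom, h⟩⟩

end Fedder

/-! ## §3 Deep support for a monomial `M = y^{M₁}` -/

/-- **A monomial with a multiplicity `≥ p` at a coordinate vanishing at `β` is deep at `β`**: `βᵢ = 0`, `M₁ i ≥ p` ⇒ `y^{M₁} ∈ ((y_j − β_j)^p)_j`. [elementary] -/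
theorem monomial_mem_span_sub_C_pow (k : Type) [Field k] {n : ℕ} (p : ℕ) (β : Fin n → k) (M₁ : Fin n →₀ ℕ) (i : Fin n) (hβ : β i = 0) (hi : p ≤ M₁ i) :
    (monomial M₁ (1 : k) : MvPolynomial (Fin n) k) ∈ Ideal.span (Set.range fun j : Fin n => (X j - C (β j) : MvPolynomial (Fin n) k) ^ p) := by
  classical
  have hdvd : (X i : MvPolynomial (Fin n) k) ^ p ∣ monomial M₁ (1 : k) :=
    ⟨monomial (M₁ - Finsupp.single i p) 1, by rw [X_pow_eq_monomial, monomial_mul, one_mul, add_tsub_cancel_of_le (Finsupp.single_le_iff.mpr hi)]⟩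
  obtain ⟨q, hq⟩ := hdvd
  rw [hq]
  refine Ideal.mul_mem_right _ _ (Ideal.subset_span ⟨i, ?_⟩)
  simp only [hβ, C_0, sub_zero]

end Summit.ResolutionOfSingularities.ResolutionOfSingularities.Theorems.FInjectiveMacaulayfication.PencilDeepSupportFedder

end
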